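import Summits.AtomisticToContinuum.HydrodynamicLimit.Theorems.JParityClosureRateFloorPairFunctionalTermsRung0
import HarnessLib

/-!
# The B-side of `RateFloor` at rung 0, IV: the r-mollified ideal pair functional of a GENERAL nonnegative mark is close to its
# ideal value in `L¹` under the canonical Gibbs law (helper file, `--supports stmt-AtomisticToContinuum-13080`)

Crux `JParityClosure.RateFloor` (stmt-AtomisticToContinuum-13080), line `Sketch`, rung-0 stub `stub_staticOpacityFloorRung0`
("the r-scale LLN of the B-side").  For constant profiles `(a, u, θ)` and EVERY continuous mark `0 ≤ Ξ ≤ C` (no truncation, no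
density cutoff — the crux's B-side carries the full mark), every `0 < r`, `x₀ ∈ 𝕋³`, with `Θ̄_Ξ = ∫ Θ Ξ d(N(u,θ) ⊗ N(u,θ))`,
`M = 3/(πr³)`, `C_Θ = C·2L·|S²|`, `m₂ = ‖u‖² + 3θ`, `V_N = E_P(ρ̃_r(·,x₀) − 1)²` (`integral_abs_pairFunctional_sub_le`):

  `E_{G_N} |B_r Ξ (·, x₀) − Θ̄_Ξ| ≤ [η/2 + 8M⁴C_Θ²/((N+1)2η)] + C_Θ[(M+1)(η′ + V_N/(4η′)) + M²/(N+1)] + 4M²(C|S²|/L)m₂ + (C|S²|/L)4m₂`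

for all `L, η, η′ > 0` — hence `→ 0` as `N → ∞` (choose `L`, then `η, η′`, then `N`; `V_N → 0` is
`tendsto_integral_sq_empDensity_sub_one`).  Proof: split `Ξ = Ξψ_L + Ξ(1 − ψ_L)` (`…PairFunctionalMarks`), the three `G`-level
terms of `…PairFunctionalTermsRung0`, and the tail of `Θ̄` `≤ (C|S²|/L)·4m₂`.

The one-sided flow transfer (Markov on `∫₀^τ∫ χ (B − Θ̄)₊`, Gibbs invariance, translation invariance) that turns this into the
in-probability upper bound of the crux's B-side is the consumer's.
-/

noncomputable section

open MeasureTheory ProbabilityTheory Set Filter Topology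
open scoped ENNReal InnerProductSpace BigOperators

namespace Summit.AtomisticToContinuum.HydrodynamicLimit.Theorems

namespace RateFloorPairFunctionalUpper

open Literature.Analysis.FluidPDE Literature.MathematicalPhysics.KineticTheory
open Literature.Probability.Moments
open Summit.AtomisticToContinuum.HydrodynamicLimit.Theorems.EvenStressEnskog

/-! ## The `L¹` deviation of the pair functional from its ideal value, bounded -/

/-- **The four-term bound.**  Under the rung-0 local Gibbs law, for a continuous mark `0 ≤ Ξ ≤ C`, `0 < r`, `x₀`, `L > 0`
and `η, η′ > 0`: with `M = 3/(πr³)`, `C_Θ = C·2L·|S²|`, `m₂ = ‖u‖² + 3θ`, `V_N = E_P(ρ̃_r(·,x₀) − 1)²`,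
`E_G|B_r Ξ − Θ̄_Ξ| ≤ [η/2 + 8M⁴C_Θ²/((N+1)·2η)] + C_Θ[(M+1)(η′ + V_N/(4η′)) + M²/(N+1)] + 4M²(C|S²|/L) m₂ + (C|S²|/L) 4 m₂`.
[folklore] -/
theorem integral_abs_pairFunctional_sub_le {σ a θ : ℝ} {u : V3} (hσ2 : σ ≤ 1 / 2) (ha : 0 < a) (hθ : 0 < θ)
    {Ξ : V3 × V3 × V3 → ℝ} (hΞc : Continuous Ξ) (hΞ0 : ∀ q, 0 ≤ Ξ q) {C : ℝ} (hΞC : ∀ q, Ξ q ≤ C)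
    {r : ℝ} (hr : 0 < r) (x₀ : T3) (N : ℕ) (Φ : HardSphereFlow (Torus.geometry (Fin 3)) (hsDiameter σ N) (N + 1))
    {L η η' : ℝ} (hL : 0 < L) (hη : 0 < η) (hη' : 0 < η') :
    ∫ z, |pairFunctional r Ξ z x₀ - ∫ p, sphereMark Ξ p.1 p.2 ∂((gaussMeasure u θ).prod (gaussMeasure u θ))|
        ∂(localGibbsLaw σ (fun _ => a) (fun _ => u) (fun _ => θ) N Φ) ≤
      (η / 2 + 8 * (3 / (Real.pi * r ^ 3)) ^ 4 *
          (C * (2 * L) * (sphereMeasure : Measure (Metric.sphere (0 : V3) 1)).real univ) ^ 2 * (((N + 1 : ℕ) : ℝ))⁻¹ / (2 * η)) +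
      C * (2 * L) * (sphereMeasure : Measure (Metric.sphere (0 : V3) 1)).real univ *
        ((3 / (Real.pi * r ^ 3) + 1) * (η' + (∫ xs, (empDensity r xs x₀ - 1) ^ 2
            ∂posGibbsMeasure (fun _ : T3 => a) (hsDiameter σ N) (N + 1)) / (4 * η')) +
          (3 / (Real.pi * r ^ 3)) ^ 2 * (((N + 1 : ℕ) : ℝ))⁻¹) +
      4 * (3 / (Real.pi * r ^ 3)) ^ 2 * (C * (sphereMeasure : Measure (Metric.sphere (0 : V3) 1)).real univ / L) *
        (‖u‖ ^ 2 + 3 * θ) +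
      C * (sphereMeasure : Measure (Metric.sphere (0 : V3) 1)).real univ / L * (4 * (‖u‖ ^ 2 + 3 * θ)) := by
  haveI := isFiniteMeasure_sphereMeasure (E := V3)
  set G := localGibbsLaw σ (fun _ => a) (fun _ => u) (fun _ => θ) N Φ with hG
  set γγ : Measure (V3 × V3) := (gaussMeasure u θ).prod (gaussMeasure u θ) with hγγ
  set M : ℝ := 3 / (Real.pi * r ^ 3) with hM
  set S : ℝ := (sphereMeasure : Measure (Metric.sphere (0 : V3) 1)).real univ with hS
  set n : ℝ := ((N + 1 : ℕ) : ℝ) with hn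
  set m₂ : ℝ := ‖u‖ ^ 2 + 3 * θ with hm₂
  set CΘ : ℝ := C * (2 * L) * S with hCΘ
  set K : ℝ := C * S / L with hK
  set V : ℝ := ∫ xs, (empDensity r xs x₀ - 1) ^ 2 ∂posGibbsMeasure (fun _ : T3 => a) (hsDiameter σ N) (N + 1) with hV
  set ΞL : V3 × V3 × V3 → ℝ := fun q => Ξ q * speedCutoff L ‖q.2.2 - q.2.1‖ with hΞL
  set Ξt : V3 × V3 × V3 → ℝ := fun q => Ξ q * (1 - speedCutoff L ‖q.2.2 - q.2.1‖) with hΞt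
  set Θb : ℝ := ∫ p, sphereMark Ξ p.1 p.2 ∂γγ with hΘb
  set ΘL : ℝ := ∫ p, sphereMark ΞL p.1 p.2 ∂γγ with hΘL
  set Θt : ℝ := ∫ p, sphereMark Ξt p.1 p.2 ∂γγ with hΘt
  set Q : Config (N + 1) (Fin 3) T3 → ℝ := fun z =>
    n⁻¹ * n⁻¹ * ∑ i, ∑ j, (if i = j then 0 else coneKernel r (z i).1 x₀ * coneKernel r (z j).1 x₀) with hQ
  set pFL : Config (N + 1) (Fin 3) T3 → ℝ := fun z => pairFunctional r ΞL z x₀ with hpFL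
  set pFt : Config (N + 1) (Fin 3) T3 → ℝ := fun z => pairFunctional r Ξt z x₀ with hpFt
  haveI : IsProbabilityMeasure G := isProbabilityMeasure_localGibbsLaw continuous_const continuous_const continuous_const
    (fun _ => ha) (fun _ => hθ) hσ2 N Φ
  haveI : IsProbabilityMeasure γγ := by rw [hγγ]; infer_instance
  have hn0 : 0 < n := by rw [hn]; positivity
  have hM0 : 0 ≤ M := by rw [hM]; positivity
  have hS0 : 0 ≤ S := measureReal_nonneg
  have hC0 : 0 ≤ C := (hΞ0 0).trans (hΞC 0)
  have hCΘ0 : 0 ≤ CΘ := by rw [hCΘ]; positivity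
  have hK0 : 0 ≤ K := by rw [hK]; positivity
  -- the two parts of the mark
  have hΞLc : Continuous ΞL := continuous_truncMark hΞc L
  have hΞtc : Continuous Ξt := continuous_tailMark hΞc L
  have hΞt0 : ∀ q, 0 ≤ Ξt q := fun q => (tailMark_nonneg_le hΞ0 L q).1
  have hsplit : Ξ = fun q => ΞL q + Ξt q := by
    funext q; simp only [hΞL, hΞt]; ring
  have hΘLb : ∀ v w, |sphereMark ΞL v w| ≤ CΘ := fun v w => abs_sphereMark_truncMark_le hΞ0 hΞC hL v w
  have hΘtb : ∀ v w, sphereMark Ξt v w ≤ K * ‖w - v‖ ^ 2 := fun v w => sphereMark_tail_le hΞc hΞ0 hΞC hL v w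
  have hΘt0 : ∀ v w, 0 ≤ sphereMark Ξt v w := fun v w => sphereMark_nonneg' hΞt0 v w
  -- integrability on `γγ` and the split of `Θ̄`
  have hΘLi : Integrable (fun p : V3 × V3 => sphereMark ΞL p.1 p.2) γγ :=
    Integrable.of_bound (continuous_sphereMark hΞLc).aestronglyMeasurable CΘ
      (ae_of_all _ fun p => by rw [Real.norm_eq_abs]; exact hΘLb p.1 p.2)
  have hquad_i : Integrable (fun p : V3 × V3 => K * ‖p.2 - p.1‖ ^ 2) γγ := by
    have h1 : Integrable (fun p : V3 × V3 => ‖p.1‖ ^ 2) γγ := (integrable_norm_sq_gaussMeasure u θ).comp_fst _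
    have h2 : Integrable (fun p : V3 × V3 => ‖p.2‖ ^ 2) γγ := (integrable_norm_sq_gaussMeasure u θ).comp_snd _
    have h12 : Integrable (fun p : V3 × V3 => 2 * ‖p.1‖ ^ 2 + 2 * ‖p.2‖ ^ 2) γγ := (h1.const_mul 2).add (h2.const_mul 2)
    refine (Integrable.mono' h12 ((continuous_snd.sub continuous_fst).norm.pow 2).aestronglyMeasurable
      (ae_of_all _ fun p => ?_)).const_mul K
    rw [Real.norm_eq_abs, abs_of_nonneg (sq_nonneg _)]; exact norm_sub_sq_le_two p.1 p.2
  have hΘti : Integrable (fun p : V3 × V3 => sphereMark Ξt p.1 p.2) γγ :=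
    Integrable.mono' hquad_i (continuous_sphereMark hΞtc).aestronglyMeasurable
      (ae_of_all _ fun p => by rw [Real.norm_eq_abs, abs_of_nonneg (hΘt0 _ _)]; exact hΘtb p.1 p.2)
  have hΘsplit : Θb = ΘL + Θt := by
    rw [hΘb, hΘL, hΘt, ← integral_add hΘLi hΘti]
    refine integral_congr_ae (ae_of_all _ fun p => ?_)
    conv_lhs => rw [hsplit]
    exact sphereMark_add hΞLc hΞtc p.1 p.2
  have hΘLabs : |ΘL| ≤ CΘ := by
    have h := norm_integral_le_of_norm_le_const (μ := γγ) (f := fun p : V3 × V3 => sphereMark ΞL p.1 p.2) (C := CΘ)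
      (ae_of_all _ fun p => by rw [Real.norm_eq_abs]; exact hΘLb p.1 p.2)
    simpa only [Real.norm_eq_abs, probReal_univ, mul_one] using h
  have hΘt_nonneg : 0 ≤ Θt := integral_nonneg fun p => hΘt0 p.1 p.2
  have hΘt_le : Θt ≤ K * (4 * m₂) := by
    calc Θt ≤ ∫ p : V3 × V3, K * ‖p.2 - p.1‖ ^ 2 ∂γγ := integral_mono hΘti hquad_i fun p => hΘtb p.1 p.2
      _ = K * ∫ p : V3 × V3, ‖p.2 - p.1‖ ^ 2 ∂γγ := integral_const_mul _ _
      _ ≤ K * (4 * m₂) := mul_le_mul_of_nonneg_left (integral_norm_sub_sq_prod_gauss_le u hθ) hK0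
  -- the pair functional splits accordingly
  have hpFsplit : ∀ z, pairFunctional r Ξ z x₀ = pFL z + pFt z := fun z => by
    simp only [hpFL, hpFt]
    conv_lhs => rw [hsplit]
    exact pairFunctional_add r hΞLc hΞtc z x₀
  have hpFt0 : ∀ z, 0 ≤ pFt z := fun z => pairFunctional_nonneg hr hΞt0 z x₀
  -- pointwise inequality
  have hpt : ∀ z, |pairFunctional r Ξ z x₀ - Θb| ≤ |pFL z - ΘL * Q z| + CΘ * |Q z - 1| + pFt z + K * (4 * m₂) := by
    intro z
    rw [hpFsplit z, hΘsplit]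
    have e : pFL z + pFt z - (ΘL + Θt) = (pFL z - ΘL * Q z) + ΘL * (Q z - 1) + (pFt z - Θt) := by ring
    rw [e]
    have h1 : |pFL z - ΘL * Q z + ΘL * (Q z - 1) + (pFt z - Θt)| ≤
        |pFL z - ΘL * Q z + ΘL * (Q z - 1)| + |pFt z - Θt| := abs_add_le _ _
    have h2 : |pFL z - ΘL * Q z + ΘL * (Q z - 1)| ≤ |pFL z - ΘL * Q z| + |ΘL * (Q z - 1)| := abs_add_le _ _
    have h3 : |ΘL * (Q z - 1)| ≤ CΘ * |Q z - 1| := by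
      rw [abs_mul]; exact mul_le_mul_of_nonneg_right hΘLabs (abs_nonneg _)
    have h4 : |pFt z - Θt| ≤ pFt z + Θt := by
      rw [abs_le]; constructor <;> linarith [hpFt0 z, hΘt_nonneg]
    linarith
  -- the three `G`-level bounds
  have hT1 : ∫ z, |pFL z - ΘL * Q z| ∂G ≤ η / 2 + 8 * M ^ 4 * CΘ ^ 2 * n⁻¹ / (2 * η) := by
    have h := integral_abs_pairFunctional_sub_mul_offDiag_le (u := u) hσ2 ha hθ hΞLc hΘLb hr x₀ N Φ hη
    simpa only [hpFL, hQ, hΘL, hγγ, hn, hM] using h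
  have hT2 : ∫ z, CΘ * |Q z - 1| ∂G ≤ CΘ * ((M + 1) * (η' + V / (4 * η')) + M ^ 2 * n⁻¹) := by
    rw [integral_const_mul]
    refine mul_le_mul_of_nonneg_left ?_ hCΘ0
    have h := integral_abs_offDiag_sub_one_le (u := u) hσ2 ha hθ hr x₀ N Φ hη'
    simpa only [hQ, hn, hM, hV] using h
  have hT3 : ∫ z, pFt z ∂G ≤ 4 * M ^ 2 * K * m₂ := by
    have h := integral_pairFunctional_tail_le (u := u) hσ2 ha hθ hΞc hΞ0 hΞC hr x₀ N Φ hL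
    simpa only [hpFt, hΞt, hM, hK, hS, hm₂] using h
  -- integrability of the pieces under `G` (continuous and bounded, or dominated)
  have hbM : ∀ (z : Config (N + 1) (Fin 3) T3) i, 0 ≤ coneKernel r (z i).1 x₀ ∧ coneKernel r (z i).1 x₀ ≤ M :=
    fun z i => coneKernel_nonneg_le hr (z i).1 x₀
  have hbc : ∀ i : Fin (N + 1), Continuous fun z : Config (N + 1) (Fin 3) T3 => coneKernel r (z i).1 x₀ := fun i =>
    continuous_coneKernel_comp r (continuous_apply i).fst continuous_const
  have hQc : Continuous Q := by
    refine continuous_const.mul (continuous_finsetSum _ fun i _ => continuous_finsetSum _ fun j _ => ?_)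
    split_ifs
    · exact continuous_const
    · exact (hbc i).mul (hbc j)
  have hQabs : ∀ z, |Q z| ≤ M * M := fun z => by
    simp only [hQ]
    refine (abs_const_mul_sum_sum_le_of (B := M * M) (mul_nonneg (inv_nonneg.2 hn0.le) (inv_nonneg.2 hn0.le))
      _ fun i j => ?_).trans (le_of_eq ?_)
    · split_ifs
      · rw [abs_zero]; exact mul_nonneg hM0 hM0
      · rw [abs_mul, abs_of_nonneg (hbM z i).1, abs_of_nonneg (hbM z j).1]
        exact mul_le_mul (hbM z i).2 (hbM z j).2 (hbM z j).1 hM0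
    · have hN : ((N : ℝ) + 1) ≠ 0 := by positivity
      rw [hn]; push_cast; field_simp
  have hpFLabs : ∀ z, |pFL z| ≤ M * M * CΘ := fun z => by
    simp only [hpFL, pairFunctional_eq_sum]
    refine (abs_const_mul_sum_sum_le_of (B := M * M * CΘ) (by positivity) _ fun i j => ?_).trans (le_of_eq ?_)
    · rw [abs_mul, abs_mul, abs_of_nonneg (hbM z i).1, abs_of_nonneg (hbM z j).1]
      exact mul_le_mul (mul_le_mul (hbM z i).2 (hbM z j).2 (hbM z j).1 hM0) (hΘLb _ _) (abs_nonneg _) (mul_nonneg hM0 hM0)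
    · have hN : ((N : ℝ) + 1) ≠ 0 := by positivity
      push_cast; field_simp
  have hpFLc : Continuous pFL := continuous_pairFunctional_comp r hΞLc continuous_id continuous_const
  have hpFtc : Continuous pFt := continuous_pairFunctional_comp r hΞtc continuous_id continuous_const
  have hpFc : Continuous fun z : Config (N + 1) (Fin 3) T3 => pairFunctional r Ξ z x₀ :=
    continuous_pairFunctional_comp r hΞc continuous_id continuous_const
  have hm1 : AEStronglyMeasurable (fun z => pFL z - ΘL * Q z) G := (hpFLc.sub (continuous_const.mul hQc)).measurable.aestronglyMeasurable
  have hT1i : Integrable (fun z => |pFL z - ΘL * Q z|) G :=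
    (Integrable.of_bound hm1 (M * M * CΘ + CΘ * (M * M)) (ae_of_all _ fun z => by
      rw [Real.norm_eq_abs]
      refine (abs_sub _ _).trans (add_le_add (hpFLabs z) ?_)
      rw [abs_mul]; exact mul_le_mul hΘLabs (hQabs z) (abs_nonneg _) hCΘ0)).abs
  have hm2 : AEStronglyMeasurable (fun z => Q z - 1) G := (hQc.sub continuous_const).measurable.aestronglyMeasurable
  have hT2i : Integrable (fun z => CΘ * |Q z - 1|) G :=
    ((Integrable.of_bound hm2 (M * M + 1) (ae_of_all _ fun z => by
      rw [Real.norm_eq_abs]; exact (abs_sub _ _).trans (add_le_add (hQabs z) (by norm_num)))).abs).const_mul CΘ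
  have hT3i : Integrable pFt G := by
    -- dominated by the velocity function of `integral_pairFunctional_tail_le`
    have hveli : Integrable (fun z : Config (N + 1) (Fin 3) T3 => (4 * M ^ 2 * K) * (n⁻¹ * ∑ i, ‖(z i).2‖ ^ 2)) G := by
      rw [hG, integrable_localGibbsLaw_const_iff σ ha.le hθ u N Φ]
      have hΓi : Integrable (fun vs : Fin (N + 1) → V3 => (4 * M ^ 2 * K) * (n⁻¹ * ∑ i, ‖vs i‖ ^ 2))
          (Measure.pi fun _ : Fin (N + 1) => gaussMeasure u θ) := by
        refine ((integrable_finsetSum _ fun i _ => ?_).const_mul _).const_mul _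
        have hmp := measurePreserving_eval (fun _ : Fin (N + 1) => gaussMeasure u θ) i
        exact (hmp.integrable_comp (continuous_norm.pow 2).aestronglyMeasurable).2 (integrable_norm_sq_gaussMeasure u θ)
      haveI : IsProbabilityMeasure (posGibbsMeasure (fun _ : T3 => a) (hsDiameter σ N) (N + 1)) :=
        isProbabilityMeasure_posGibbsMeasure continuous_const (fun _ => ha) hσ2 N
      have h := hΓi.comp_snd (posGibbsMeasure (fun _ : T3 => a) (hsDiameter σ N) (N + 1))
      refine h.congr (ae_of_all _ fun p => ?_)
      simp only [zipConfig_apply]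
    refine Integrable.mono' hveli hpFtc.measurable.aestronglyMeasurable (ae_of_all _ fun z => ?_)
    rw [Real.norm_eq_abs, abs_of_nonneg (hpFt0 z)]
    have h := pairFunctional_tail_le hr hΞc hΞ0 hΞC hL z x₀
    simpa only [hpFt, hΞt, hM, hK, hS, hn] using h
  have i12 : Integrable (fun z => |pFL z - ΘL * Q z| + CΘ * |Q z - 1|) G := hT1i.add hT2i
  have i123 : Integrable (fun z => |pFL z - ΘL * Q z| + CΘ * |Q z - 1| + pFt z) G := i12.add hT3i
  have hsum_i : Integrable (fun z => |pFL z - ΘL * Q z| + CΘ * |Q z - 1| + pFt z + K * (4 * m₂)) G :=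
    i123.add (integrable_const _)
  have hLHSi : Integrable (fun z => |pairFunctional r Ξ z x₀ - Θb|) G :=
    Integrable.mono' hsum_i (hpFc.sub continuous_const).measurable.abs.aestronglyMeasurable (ae_of_all _ fun z => by
      rw [Real.norm_eq_abs, abs_abs]; exact hpt z)
  -- assemble
  have e : ∫ z, (|pFL z - ΘL * Q z| + CΘ * |Q z - 1| + pFt z + K * (4 * m₂)) ∂G =
      ∫ z, |pFL z - ΘL * Q z| ∂G + ∫ z, CΘ * |Q z - 1| ∂G + ∫ z, pFt z ∂G + K * (4 * m₂) := by
    rw [integral_add i123 (integrable_const _), integral_add i12 hT3i,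
      integral_add hT1i hT2i, integral_const, smul_eq_mul, probReal_univ, one_mul]
  calc ∫ z, |pairFunctional r Ξ z x₀ - Θb| ∂G
      ≤ ∫ z, (|pFL z - ΘL * Q z| + CΘ * |Q z - 1| + pFt z + K * (4 * m₂)) ∂G := integral_mono hLHSi hsum_i hpt
    _ = ∫ z, |pFL z - ΘL * Q z| ∂G + ∫ z, CΘ * |Q z - 1| ∂G + ∫ z, pFt z ∂G + K * (4 * m₂) := e
    _ ≤ (η / 2 + 8 * M ^ 4 * CΘ ^ 2 * n⁻¹ / (2 * η)) + CΘ * ((M + 1) * (η' + V / (4 * η')) + M ^ 2 * n⁻¹) +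
          4 * M ^ 2 * K * m₂ + K * (4 * m₂) := add_le_add (add_le_add (add_le_add hT1 hT2) hT3) le_rfl

/-- **Registered helper stub `stub_absPairFunctionalSubLeRung0`** of crux stmt-AtomisticToContinuum-13080 (line `Sketch`, input of `stub_staticOpacityFloorRung0`),
closed signature form of the file's main result. [folklore] -/
theorem stub_absPairFunctionalSubLeRung0 : ∀ (σ a θ : ℝ) (u : V3), σ ≤ 1 / 2 → 0 < a → 0 < θ → ∀ (Ξ : V3 × V3 × V3 → ℝ), Continuous Ξ → (∀ q, 0 ≤ Ξ q) → ∀ (C : ℝ), (∀ q, Ξ q ≤ C) → ∀ (r : ℝ), 0 < r → ∀ (x₀ : T3) (N : ℕ) (Φ : HardSphereFlow (Torus.geometry (Fin 3)) (hsDiameter σ N) (N + 1)) (L η η' : ℝ), 0 < L → 0 < η → 0 < η' → ∫ z, |pairFunctional r Ξ z x₀ - ∫ p, sphereMark Ξ p.1 p.2 ∂((gaussMeasure u θ).prod (gaussMeasure u θ))| ∂(localGibbsLaw σ (fun _ => a) (fun _ => u) (fun _ => θ) N Φ) ≤ (η / 2 + 8 * (3 / (Real.pi * r ^ 3)) ^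 4 * (C * (2 * L) * (sphereMeasure : MeasureTheory.Measure (Metric.sphere (0 : V3) 1)).real Set.univ) ^ 2 * (((N + 1 : ℕ) : ℝ))⁻¹ / (2 * η)) + C * (2 * L) * (sphereMeasure : MeasureTheory.Measure (Metric.sphere (0 : V3) 1)).real Set.univ * ((3 / (Real.pi * r ^ 3) + 1) * (η' + (∫ xs, (empDensity r xs x₀ - 1) ^ 2 ∂posGibbsMeasure (fun _ : T3 => a) (hsDiameter σ N) (N + 1)) / (4 * η')) + (3 / (Real.pi * r ^ 3)) ^ 2 * (((N + 1 : ℕ) : ℝ))⁻¹) + 4 * (3 / (Real.pi * r ^ 3)) ^ 2 * (C * (sphereMeasure : MeasureTheory.Measure (Metric.sphere (0 : V3) 1)).real Set.univ / L) * (‖u‖ ^ 2 + 3 * θ) + C * (sphereMeasure : MeasureTheory.Measure (Metric.sphere (0 : V3) 1)).real Set.univ / L * (4 * (‖u‖ ^ 2 + 3 * θ)) :=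
  fun _σ _a _θ u hσ2 ha hθ _Ξ hΞc hΞ0 _C hΞC _r hr x₀ N Φ _L _η _η' hL hη hη' =>
    integral_abs_pairFunctional_sub_le (u := u) hσ2 ha hθ hΞc hΞ0 hΞC hr x₀ N Φ hL hη hη'

end RateFloorPairFunctionalUpper

end Summit.AtomisticToContinuum.HydrodynamicLimit.Theorems

end
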